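import Summits.QuantumFields.YangMills.Theorems.UV3ACLargeFieldEnvelopeAtLevel
import Literature.MathematicalPhysics.QuantumFieldTheory.Balaban1983to89.T3HeightwiseDensityBounds
import HarnessLib

/-!
# `UV3ACBounds5Upper` — R3 (cell `ym3-torus`, YM₃ on T³ — a ladder RUNG, NOT d = 4, NOT infinite volume, NOT a mass gap, NOT the Clay problem):
# **[Balaban1985UV3] THEOREM 1 (5), UPPER HALF, READ HEIGHTWISE FOR THE PINNED `ℰp` DENSITIES — lit `Bounds5UpperAtHeight F γ E` — FROM THE v3 (α) PACKAGE AND THREE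
# PER-HEIGHT ROWS OF SECT. D** (the interaction row (46), the counterterm row (62)–(65), the remainder row of (41))

Width seat `ym3-torus-px8` g15 (★★OWNER WORD 102 «GO (O-UP)»; LOCATE `LOCATE-END-THM1-TO-BOUNDS5-px8g15.md`, 20520 evidence #59).  THEOREMS ONLY (0 `def`, 0 `sorry`,
default heartbeats); `--supports stmt-QuantumFields-20520 --as helper`; count-neutral.

WHAT.  The 20520 persistence organ's K-UNIFORM upper letter ⟨UP⟩ is lit `T3HeightwiseDensityBounds.HeightwiseUpperBound F γ`, derived from the printed currency
`Bounds5UpperAtHeight F γ E` ∧ `PartitionBounds6` (lit ✓`heightwiseUpperBound_of_bounds5`) or from `Bounds5UpperAtHeight` + one lower letter (w5 ✓`heightwiseUpperBound_of_bounds5TwoSided`).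
THIS FILE proves `Bounds5UpperAtHeight F γ (fun K => E(γ,K))` — [Balaban1985UV3] (5) upper half «ρ_k(U) ≤ exp O(1)|T₁^{(k)}|» at `k = K − n`, ONE constant per height `n`, ALL runs
`K ≥ n` — for the PINNED densities of the v3 (α) package at `(γ, K)` (`E(γ, K)` = the package's start constant `E = E_0 = Σ_{i<K} E^{(i)}` of (62)∕(64)), from:
(i) the v3 package `AlphaInputsT3AC.OfV3At F 𝔠 a₀ a₁` (OPEN hypothesis schema — the socket of record of R3): its (41) with the windowed pinned weights, `dV`-a.e., every level
(✓`AlphaInputsT3AC.PkgAtV3.resDensity_le_sum_ae`); (ii) ✓`UV3ACLargeFieldEnvelopeAtLevel.exists_lfSum_le_exp_ae` — the (41)_k large-field history sum is K-uniformly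
essentially bounded at every level (the resummation of pp.273–274 under the hTop mass envelope); (iii) THREE DISPLAYED PER-HEIGHT ROWS in [B10]'s letters (the other three
piece-bounds of `B10.upper5_of_41`): (46) `|Pint_{K−n}(r, W)| ≤ a_n·N_n³`, (62)–(65) `|E_{K−n}| ≤ b_n·N_n³`, the remainder `Rm_{K−n} ≤ c_n·N_n³` (`N_n = 2L^{m+n}` = sites per direction
at height `n`; one constant per height, all `K ≥ n` — print's «O(1) independent of ε, k, g_k in a bounded set»: at height `n` the coupling `g_{K−n} = √(γL^{−n})` is one point).
* §1 counts: `#Site(F.P K, K − n) = N_n³`, `#PBond(F.P K, K − n) = 3·N_n³` (K-FREE).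
* §2 ★ `sum_wtP_pint_le` — pulling the interaction row out of the history sum.
* §3 ★★★ `bounds5UpperAtHeight_of_v3_rows` — the theorem.
HONEST SCOPE.  A knit; CONDITIONAL on the OPEN v3 package and on the three displayed rows ((46) ⟸ `Bound46AC` + the (44) display; (62)–(65) ⟸ `B10.Ecst_abs_le_window` over the AC
pieces' `estep62`∕`logZT`∕`PprT` leaves; `Rm` ⟸ its closed form — their discharge is the successor file); nothing of Bałaban's analysis is asserted; ⟨UP⟩∕PERS₁∘∕TUBE∘∕20520∕19936,
the rung, d = 4, a mass gap or Clay are NOT proved here; the Yang–Mills mass gap is NOT proved.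

References: T. Bałaban, Commun. Math. Phys. **102** (1985) 255–275 [Balaban1985UV3] ((5) p.256, Thm 1 p.257, (41) p.266, (46) p.267, (62) p.271, (64)–(65) p.273, Sect. D
pp.272–274).
-/

set_option autoImplicit false

noncomputable section

namespace Summit.QuantumFields.YangMills.Theorems.UV3ACBounds5Upper

open MeasureTheory
open scoped BigOperators ENNReal
open Literature.MathematicalPhysics.QuantumFieldTheory.Balaban1983to89
open Literature.MathematicalPhysics.QuantumFieldTheory.Balaban1983to89.T3ContinuumYM3Torus
open Literature.MathematicalPhysics.QuantumFieldTheory.Balaban1983to89.T3LevelShift (fieldShift measurePreserving_fieldShift bondShift)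
open Literature.MathematicalPhysics.QuantumFieldTheory.Balaban1983to89.T3UnitLawDensityEML (ℰp)
open Literature.MathematicalPhysics.QuantumFieldTheory.Balaban1983to89.T3RestrictedUnitDensity (resDensity)
open Literature.MathematicalPhysics.QuantumFieldTheory.Balaban1983to89.T3TiltDescent (heightDensity)
open Literature.MathematicalPhysics.QuantumFieldTheory.Balaban1983to89.T3HeightwiseDensityBounds (Bounds5UpperAtHeight)
open Literature.MathematicalPhysics.QuantumFieldTheory.Balaban1985CMP102
open Literature.MathematicalPhysics.QuantumFieldTheory.Balaban1985CMP102.Setting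
open Summit.QuantumFields.Balaban3D.Carriers
open Summit.QuantumFields.Balaban3D.Proofs.Primitives
open Summit.QuantumFields.Balaban3D.Proofs.GroupModelLieC (lieC)
open Summit.QuantumFields.Balaban3D.Proofs.TowerAC
open Summit.QuantumFields.Balaban3D.Proofs.StandardAC
open Summit.QuantumFields.Balaban3D.Proofs.InputsAC
open Summit.QuantumFields.YangMills.Theorems.UV3ACLargeFieldEnvelopeAtLevel (exists_lfSum_le_exp_ae)

variable (F : T3Family)

/-! ## §1 The counts at level `K − n` of run `K` are the height-`n` counts -/

/-- `#Site(F.P K, K − n) = N_n³` with `N_n = (F.P n).sitesPerDir 0 = 2L^{m+n}` — K-FREE (lit `card_site`, `T3LevelShift.sitesPerDir_eq`). [cite: Balaban1985UV3, p.256 («|T₁^{(k)}| = (Lᵏε)^{−3}|T_ε|»)] -/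
theorem card_site_level_eq {n K : ℕ} (hK : n ≤ K) :
    (Fintype.card (Site (F.P K) (K - n)) : ℝ) = ((F.P n).sitesPerDir 0 : ℝ) ^ 3 := by
  rw [Site.card_site]
  have hd : (F.P K).d = 3 := rfl
  have hs : (F.P K).sitesPerDir (K - n) = (F.P n).sitesPerDir 0 :=
    (F.sitesPerDir_eq (m := F.m) (K := n) (j := 0) (m' := F.m) (K' := K) (j' := K - n) (by omega)).symm
  rw [hd, hs]
  push_cast
  ring

/-- `#PBond(F.P K, K − n) = 3·N_n³` — K-FREE (a bond is (source site, direction)). [cite: Balaban1985UV3, p.256] -/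
theorem card_pBond_level_eq {n K : ℕ} (hK : n ≤ K) :
    (Fintype.card (PBond (F.P K) (K - n)) : ℝ) = 3 * ((F.P n).sitesPerDir 0 : ℝ) ^ 3 := by
  have h1 : Fintype.card (PBond (F.P K) (K - n)) = Fintype.card (Site (F.P K) (K - n)) * 3 := by
    rw [Fintype.card_congr (⟨fun b => (b.src, b.dir), fun q => ⟨q.1, q.2⟩, fun _ => rfl, fun _ => rfl⟩ :
      PBond (F.P K) (K - n) ≃ Site (F.P K) (K - n) × Fin (F.P K).d), Fintype.card_prod, Fintype.card_fin]
    rfl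
  rw [h1, Nat.cast_mul, card_site_level_eq F hK]
  push_cast
  ring

/-! ## §2 Pulling the interaction row out of the history sum -/

/-- ★ If `Pint_k(r, W) ≤ a` for every history and the weights are `≥ 0`, then `Σ_r w_r·exp(−mainT + Pint + Zterm) ≤ e^{a}·Σ_r w_r·exp(−mainT + Zterm)`. [folklore] -/
theorem sum_weight_pint_le {ι : Type*} [Fintype ι] (w mainT Pint Zterm : ι → ℝ) (a : ℝ) (hw : ∀ r, 0 ≤ w r) (hP : ∀ r, Pint r ≤ a) :
    ∑ r, w r * Real.exp (-(mainT r) + Pint r + Zterm r) ≤ Real.exp a * ∑ r, w r * Real.exp (-(mainT r) + Zterm r) := by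
  rw [Finset.mul_sum]
  refine Finset.sum_le_sum fun r _ => ?_
  rw [mul_left_comm, ← Real.exp_add]
  exact mul_le_mul_of_nonneg_left (Real.exp_le_exp.mpr (by linarith [hP r])) (hw r)

/-! ## §3 Theorem 1 (5), upper half, heightwise, for the pinned densities of the v3 package -/

variable {F} {𝔠 : AlphaConsts F.L (suGroupModel 2).N}

/-- ★★★ **[Balaban1985UV3] THM 1 (5) UPPER, HEIGHTWISE — lit `Bounds5UpperAtHeight F γ E` VERBATIM — FOR THE PINNED `blockAvg ℰp` DENSITIES OF THE v3 (α) PACKAGE**, with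
`E K :=` the package's start constant at `(γ, K)`, on `0 < γ ≤ (min γ₀ 1)²`, FROM: the v3 package `h : AlphaInputsT3AC.OfV3At F 𝔠 a₀ a₁` (its (41) a.e. at every level,
✓`PkgAtV3.resDensity_le_sum_ae`), the K-uniform a.e. bound of the (41)_k large-field sum (✓`UV3ACLargeFieldEnvelopeAtLevel.exists_lfSum_le_exp_ae`, the hTop mass envelope being px20 g12's ✓`massP_le_exp_ae_of_level`), and three
DISPLAYED per-height rows in [B10]'s letters — `hP` (46): `|Pint_{K−n}(r,W)| ≤ a_n·N_n³`; `hE` (62)–(65): `|E_{K−n}| ≤ b_n·N_n³`; `hR`: `Rm_{K−n} ≤ c_n·N_n³` (`N_n = (F.P n).sitesPerDir 0`).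
The constant of (5) at height `n` is `O1_n := a_n + b_n + c_n + 3A + 3∕(½ log L)` (`A` = the family's hTop mass-envelope constant).  Proof: at `j = K − n`, a.e. in `W`,
`e^{−E}ρ^{univ}_j ≤ exp(−E_j + Rm_j)·Σ_r wtP·e^{−mainT+Pint+Zterm} ≤ exp(−E_j + Rm_j + a_nN³)·Σ_r wtP·e^{−mainT+Zterm} ≤ exp((a_n+b_n+c_n)N³ + 3N³A + (3∕ℓ)N³)` (§1∕§2), then read on the
`n`-th tower's finest lattice along the measure-preserving `fieldShift` (lit `heightDensity` = `resDensity ∘ fieldShift`).  HONEST: conditional on the OPEN package and the three rows;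
nothing of Bałaban's analysis asserted; ⟨UP⟩ needs (6)∕a lower letter on top (lit ✓`heightwiseUpperBound_of_bounds5`, w5 ✓`heightwiseUpperBound_of_bounds5TwoSided`).
[cite: Balaban1985UV3, (5) p.256, Thm 1 p.257, (41) p.266, (46) p.267, (62) p.271, (64)–(65) p.273, Sect. D pp.272–274] -/
theorem bounds5UpperAtHeight_of_v3_rows {a₀ a₁ : ℝ} (h : AlphaInputsT3AC.OfV3At F 𝔠 a₀ a₁) (hc : 0 < a₀ ∧ 0 < a₁ ∧ 𝔠.B₃ * a₁ ≤ a₀)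
    (γ : ℝ) (hγ : 0 < γ) (hγ1 : γ ≤ (min 𝔠.gamma0 1) ^ 2)
    (hP : ∀ n : ℕ, ∃ a : ℝ, ∀ (K : ℕ) (hK : n ≤ K) (r : Hist (F.P K) (K - n))
      (W : GaugeField (F.P K) (K - n) (Matrix.specialUnitaryGroup (Fin 2) ℂ)),
      |(h.pkgAtV3 hc γ hγ hγ1 K).T.Pint (K - n) r W| ≤ a * ((F.P n).sitesPerDir 0 : ℝ) ^ 3)
    (hE : ∀ n : ℕ, ∃ b : ℝ, ∀ (K : ℕ) (hK : n ≤ K), |(h.pkgAtV3 hc γ hγ hγ1 K).T.Ecst (K - n)| ≤ b * ((F.P n).sitesPerDir 0 : ℝ) ^ 3)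
    (hR : ∀ n : ℕ, ∃ c : ℝ, ∀ (K : ℕ) (hK : n ≤ K), (h.pkgAtV3 hc γ hγ hγ1 K).T.Rm (K - n) ≤ c * ((F.P n).sitesPerDir 0 : ℝ) ^ 3) :
    Bounds5UpperAtHeight F γ (fun K => (h.pkgAtV3 hc γ hγ hγ1 K).E) := by
  intro n
  obtain ⟨a, ha⟩ := hP n
  obtain ⟨b, hb⟩ := hE n
  obtain ⟨c, hcR⟩ := hR n
  obtain ⟨A, _, hlfF⟩ := exists_lfSum_le_exp_ae F
  refine ⟨a + b + c + 3 * A + 3 / (Real.log F.L / 2), fun K hK => ?_⟩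
  set p := h.pkgAtV3 hc γ hγ hγ1 K with hp
  set N : ℝ := ((F.P n).sitesPerDir 0 : ℝ) with hN
  have hjK : K - n ≤ K := Nat.sub_le K n
  -- the two a.e. letters at level `j = K − n` of run `K`
  have hlf := hlfF 𝔠 γ hγ hγ1 K p (K - n) hjK
  have hres := p.resDensity_le_sum_ae (K - n) hjK
  -- counts
  have hS : (Fintype.card (Site (F.P K) (K - n)) : ℝ) = N ^ 3 := card_site_level_eq F hK
  have hB : (Fintype.card (PBond (F.P K) (K - n)) : ℝ) = 3 * N ^ 3 := card_pBond_level_eq F hK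
  -- the bound on the level-`(K − n)` lattice of run `K`, a.e.
  have hlev : ∀ᵐ W ∂fieldMeasure (F.P K) (K - n) (Matrix.specialUnitaryGroup (Fin 2) ℂ),
      Real.exp (-p.E) * resDensity F γ K Set.univ (K - n) W ≤ Real.exp ((a + b + c + 3 * A + 3 / (Real.log F.L / 2)) * N ^ 3) := by
    filter_upwards [hlf, hres] with W hW hW41
    have hw0 : ∀ r : Hist (F.P K) (K - n), 0 ≤ p.wtP (K - n) r W := fun r =>
      (PinnedStep.wtP_nonneg_le 𝔠.lane p.X (AlphaInputsT3AC.admWindowT3 F 𝔠 γ hγ hγ1 K) (K - n) r W).1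
    have hsum := sum_weight_pint_le (fun r => p.wtP (K - n) r W) (fun r => p.T.mainT (K - n) r W) (fun r => p.T.Pint (K - n) r W)
      (fun r => p.T.Zterm (K - n) r) (a * N ^ 3) hw0 (fun r => (abs_le.mp (ha K hK r W)).2)
    have hEb := (abs_le.mp (hb K hK)).1
    have hRc := hcR K hK
    have hexp0 : 0 < Real.exp (-(p.T.Ecst (K - n) - p.E) + p.T.Rm (K - n)) := Real.exp_pos _
    -- `ρ ≤ exp(−(E_j − E) + Rm_j)·exp(aN³)·exp(3N³A)·exp((3∕ℓ)N³)`
    have h1 : resDensity F γ K Set.univ (K - n) W ≤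
        Real.exp (-(p.T.Ecst (K - n) - p.E) + p.T.Rm (K - n)) *
          (Real.exp (a * N ^ 3) * Real.exp ((Fintype.card (PBond (F.P K) (K - n)) : ℝ) * A +
            3 / (Real.log F.L / 2) * (Fintype.card (Site (F.P K) (K - n)) : ℝ))) := by
      refine hW41.trans (mul_le_mul_of_nonneg_left (hsum.trans ?_) hexp0.le)
      exact mul_le_mul_of_nonneg_left hW (Real.exp_pos _).le
    rw [hB, hS] at h1
    have h2 : Real.exp (-p.E) * resDensity F γ K Set.univ (K - n) W ≤
        Real.exp (-p.E) * (Real.exp (-(p.T.Ecst (K - n) - p.E) + p.T.Rm (K - n)) *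
          (Real.exp (a * N ^ 3) * Real.exp (3 * N ^ 3 * A + 3 / (Real.log F.L / 2) * N ^ 3))) :=
      mul_le_mul_of_nonneg_left h1 (Real.exp_pos _).le
    refine h2.trans ?_
    rw [← Real.exp_add, ← Real.exp_add, ← Real.exp_add]
    exact Real.exp_le_exp.mpr (by linarith [hEb, hRc])
  -- read on the `n`-th tower's finest lattice: `heightDensity = resDensity ∘ fieldShift`, `fieldShift` measure preserving
  have hmp := measurePreserving_fieldShift (G := Matrix.specialUnitaryGroup (Fin 2) ℂ)
    (F.sitesPerDir_eq (m := F.m) (K := K) (j := K - n) (m' := F.m) (K' := n) (j' := 0) (by omega))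
  filter_upwards [hmp.quasiMeasurePreserving.ae hlev] with V hV
  exact hV

end Summit.QuantumFields.YangMills.Theorems.UV3ACBounds5Upper

end
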